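import Mathlib.Analysis.InnerProductSpace.PiL2
import Mathlib.Analysis.SpecialFunctions.Trigonometric.Basic
import Mathlib.Analysis.SpecialFunctions.Sqrt
import Mathlib.Data.Int.Order.Units
import Summits.CriticalPhenomena.Ising3DConformalLimit.Theorems.MoebiusLimitExists.Negative.FreePermutations
import HarnessLib

/-!
# Crux `RotationUpgradeFromTwoPoint` (stmt-CriticalPhenomena-8367), line `two-crystals-generate-so3`:
# explicit isometries of `ℝ³` (route-posited objects, `Defs`-type file)

The explicit linear isometries of `E3 = EuclideanSpace ℝ (Fin 3)` used by the line's composition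
(`Theorems/GaussianScaleMixtureRotationUpgradeFromTwoPointReduction.lean`) and by its registered
stubs: a constructor `isoOfLinear` (mutually inverse norm-preserving linear maps ⇒ `≃ₗᵢ`), the
coordinate rotations `rotZ φ`, `rotX φ` (matrices `rotZMat`, `rotXMat`), the symmetric orthogonal
frame `frameW = (1/√5)·!![-1,0,2; 0,-√5,0; 2,0,1]` (`frameW_frameW : W (W v) = v`), the signed
coordinate isometries `signedIso π ε : x ↦ (ε₀ x_{π 0}, ε₁ x_{π 1}, ε₂ x_{π 2})` and the four
instances used (`rzNeg90`, `rx90`, `rc`, `flip0`), the sixfold rotation `rz60 = rotZ (π/3)` with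
`rz30_apply : rz60 ∘ rz60 ∘ rzNeg90 = R_z(30°)`, and the two one-parameter groups
`circleZ φ = W R_z(φ) W`, `circleX φ = W R_x(φ) W` (group law, `circleZ (2π) = 1`, continuity in
`φ`). Every map comes with its coordinate formula (`…_apply`). Nothing is asserted about the Ising
model here. (Standard linear algebra; Di Francesco–Mathieu–Sénéchal 1997 §4.1 for the role of
`O(3)`.)
-/

noncomputable section

open Literature.Probability.LatticeModels Finset

namespace Summit.CriticalPhenomena.Ising3DConformalLimit.Cruxes.RotationUpgradeFromTwoPoint.TwoCrystalsGenerateSo3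

local notation "E3" => EuclideanSpace ℝ (Fin 3)

/-! ### Coordinates, norms, the isometry constructor -/

/-- The real-linear map of a real `3 × 3` matrix on `ℝ³`. [folklore] -/
abbrev rlin (M : Matrix (Fin 3) (Fin 3) ℝ) : E3 →ₗ[ℝ] E3 := Matrix.toEuclideanLin M

/-- Coordinates of `rlin`. [folklore] -/
theorem rlin_apply (M : Matrix (Fin 3) (Fin 3) ℝ) (v : E3) (j : Fin 3) :
    rlin M v j = ∑ k, M j k * v k := by
  simp [rlin, Matrix.toEuclideanLin, Matrix.toLpLin_apply, Matrix.mulVec, dotProduct]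

/-- Two vectors of `ℝ³` with the same squared coordinates sum have the same norm (the squared norm
is `v 0 ^ 2 + v 1 ^ 2 + v 2 ^ 2`, cf. `Literature.Geometry.Lorentzian.E3.norm_sq`). [folklore] -/
theorem norm_eq_of_sq {v w : E3} (h : v 0 ^ 2 + v 1 ^ 2 + v 2 ^ 2 = w 0 ^ 2 + w 1 ^ 2 + w 2 ^ 2) :
    ‖v‖ = ‖w‖ := by
  have hsq : ∀ u : E3, ‖u‖ ^ 2 = u 0 ^ 2 + u 1 ^ 2 + u 2 ^ 2 := fun u => by
    rw [EuclideanSpace.norm_eq, Real.sq_sqrt (Finset.sum_nonneg fun i _ => sq_nonneg _)]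
    simp [Fin.sum_univ_three, Real.norm_eq_abs, sq_abs]
  have : ‖v‖ ^ 2 = ‖w‖ ^ 2 := by rw [hsq v, hsq w, h]
  exact (sq_eq_sq₀ (norm_nonneg _) (norm_nonneg _)).1 this

/-- Build a linear isometry of `ℝ³` from two mutually inverse linear maps, the first norm
preserving. [folklore] -/
def isoOfLinear (f g : E3 →ₗ[ℝ] E3) (h₁ : ∀ x, g (f x) = x) (h₂ : ∀ x, f (g x) = x)
    (hn : ∀ x, ‖f x‖ = ‖x‖) : E3 ≃ₗᵢ[ℝ] E3 :=
  LinearIsometryEquiv.mk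
    (LinearEquiv.ofLinear f g (LinearMap.ext h₂) (LinearMap.ext h₁) : E3 ≃ₗ[ℝ] E3) hn

/-- `isoOfLinear` acts as `f`. [folklore] -/
@[simp] theorem isoOfLinear_apply (f g : E3 →ₗ[ℝ] E3) (h₁ : ∀ x, g (f x) = x)
    (h₂ : ∀ x, f (g x) = x) (hn : ∀ x, ‖f x‖ = ‖x‖) (x : E3) :
    isoOfLinear f g h₁ h₂ hn x = f x := rfl

/-! ### Coordinate rotations, the frame `W`, signed coordinate isometries -/

/-- Matrix of the rotation `R_z(φ)`. [folklore] -/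
def rotZMat (φ : ℝ) : Matrix (Fin 3) (Fin 3) ℝ :=
  !![Real.cos φ, -Real.sin φ, 0; Real.sin φ, Real.cos φ, 0; 0, 0, 1]

/-- Matrix of the rotation `R_x(φ)`. [folklore] -/
def rotXMat (φ : ℝ) : Matrix (Fin 3) (Fin 3) ℝ :=
  !![1, 0, 0; 0, Real.cos φ, -Real.sin φ; 0, Real.sin φ, Real.cos φ]

/-- `R_z(φ)` in coordinates. [folklore] -/
theorem rotZ_lin_apply (φ : ℝ) (v : E3) : rlin (rotZMat φ) v = WithLp.toLp 2
    ![Real.cos φ * v 0 - Real.sin φ * v 1, Real.sin φ * v 0 + Real.cos φ * v 1, v 2] := by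
  ext j; rw [rlin_apply]; (fin_cases j <;> simp [rotZMat, Fin.sum_univ_three]); ring

/-- `R_x(φ)` in coordinates. [folklore] -/
theorem rotX_lin_apply (φ : ℝ) (v : E3) : rlin (rotXMat φ) v = WithLp.toLp 2
    ![v 0, Real.cos φ * v 1 - Real.sin φ * v 2, Real.sin φ * v 1 + Real.cos φ * v 2] := by
  ext j; rw [rlin_apply]; (fin_cases j <;> simp [rotXMat, Fin.sum_univ_three]); ring

/-- The rotation `R_z(φ)` as a linear isometry of `ℝ³`. [folklore] -/
def rotZ (φ : ℝ) : E3 ≃ₗᵢ[ℝ] E3 :=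
  isoOfLinear (rlin (rotZMat φ)) (rlin (rotZMat (-φ)))
    (by
      intro x
      have hc := Real.cos_sq_add_sin_sq φ
      rw [rotZ_lin_apply, rotZ_lin_apply]
      ext j; fin_cases j
      · simp [Real.cos_neg, Real.sin_neg]; linear_combination (x 0) * hc
      · simp [Real.cos_neg, Real.sin_neg]; linear_combination (x 1) * hc
      · simp)
    (by
      intro x
      have hc := Real.cos_sq_add_sin_sq φ
      rw [rotZ_lin_apply, rotZ_lin_apply]
      ext j; fin_cases j
      · simp [Real.cos_neg, Real.sin_neg]; linear_combination (x 0) * hc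
      · simp [Real.cos_neg, Real.sin_neg]; linear_combination (x 1) * hc
      · simp)
    (by
      intro x
      apply norm_eq_of_sq
      rw [rotZ_lin_apply]
      simp
      linear_combination (x 0 ^ 2 + x 1 ^ 2) * Real.cos_sq_add_sin_sq φ)

/-- `R_z(φ)` in coordinates. [folklore] -/
theorem rotZ_apply (φ : ℝ) (v : E3) : rotZ φ v = WithLp.toLp 2
    ![Real.cos φ * v 0 - Real.sin φ * v 1, Real.sin φ * v 0 + Real.cos φ * v 1, v 2] := by
  rw [rotZ, isoOfLinear_apply, rotZ_lin_apply]

/-- The rotation `R_x(φ)` as a linear isometry of `ℝ³`. [folklore] -/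
def rotX (φ : ℝ) : E3 ≃ₗᵢ[ℝ] E3 :=
  isoOfLinear (rlin (rotXMat φ)) (rlin (rotXMat (-φ)))
    (by
      intro x
      have hc := Real.cos_sq_add_sin_sq φ
      rw [rotX_lin_apply, rotX_lin_apply]
      ext j; fin_cases j
      · simp
      · simp [Real.cos_neg, Real.sin_neg]; linear_combination (x 1) * hc
      · simp [Real.cos_neg, Real.sin_neg]; linear_combination (x 2) * hc)
    (by
      intro x
      have hc := Real.cos_sq_add_sin_sq φ
      rw [rotX_lin_apply, rotX_lin_apply]
      ext j; fin_cases j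
      · simp
      · simp [Real.cos_neg, Real.sin_neg]; linear_combination (x 1) * hc
      · simp [Real.cos_neg, Real.sin_neg]; linear_combination (x 2) * hc)
    (by
      intro x
      apply norm_eq_of_sq
      rw [rotX_lin_apply]
      simp
      linear_combination (x 1 ^ 2 + x 2 ^ 2) * Real.cos_sq_add_sin_sq φ)

/-- `R_x(φ)` in coordinates. [folklore] -/
theorem rotX_apply (φ : ℝ) (v : E3) : rotX φ v = WithLp.toLp 2
    ![v 0, Real.cos φ * v 1 - Real.sin φ * v 2, Real.sin φ * v 1 + Real.cos φ * v 2] := by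
  rw [rotX, isoOfLinear_apply, rotX_lin_apply]

/-- Matrix of the symmetric orthogonal frame `W` (`W e₀ = (-1,0,2)/√5`, `W e₁ = -e₁`,
`W e₂ = (2,0,1)/√5`, `W² = 1`). [folklore] -/
def frameWMat : Matrix (Fin 3) (Fin 3) ℝ :=
  !![-1 / Real.sqrt 5, 0, 2 / Real.sqrt 5; 0, -1, 0; 2 / Real.sqrt 5, 0, 1 / Real.sqrt 5]

/-- `W` in coordinates. [folklore] -/
theorem frameW_lin_apply (v : E3) : rlin frameWMat v = WithLp.toLp 2
    ![(-v 0 + 2 * v 2) / Real.sqrt 5, -v 1, (2 * v 0 + v 2) / Real.sqrt 5] := by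
  ext j; rw [rlin_apply]; fin_cases j <;> simp [frameWMat, Fin.sum_univ_three] <;> ring

/-- `√5 ≠ 0` and `(√5)² = 5`. [folklore] -/
theorem sqrt5_facts : Real.sqrt 5 ≠ 0 ∧ Real.sqrt 5 ^ 2 = 5 :=
  ⟨by positivity, Real.sq_sqrt (by norm_num)⟩

/-- `W (W v) = v`. [folklore] -/
theorem frameW_lin_involutive (v : E3) : rlin frameWMat (rlin frameWMat v) = v := by
  obtain ⟨h0, h5⟩ := sqrt5_facts
  rw [frameW_lin_apply, frameW_lin_apply]
  ext j; fin_cases j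
  · simp; field_simp
    linear_combination (-(v 0)) * h5
  · simp
  · simp; field_simp
    linear_combination (-(v 2)) * h5

/-- The frame `W` as a linear isometry of `ℝ³`. [folklore] -/
def frameW : E3 ≃ₗᵢ[ℝ] E3 :=
  isoOfLinear (rlin frameWMat) (rlin frameWMat) frameW_lin_involutive frameW_lin_involutive
    (by
      intro x
      obtain ⟨h0, h5⟩ := sqrt5_facts
      apply norm_eq_of_sq
      rw [frameW_lin_apply]
      simp
      field_simp
      linear_combination (-(x 0 ^ 2 + x 2 ^ 2)) * h5)

/-- `W` in coordinates. [folklore] -/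
theorem frameW_apply (v : E3) : frameW v = WithLp.toLp 2
    ![(-v 0 + 2 * v 2) / Real.sqrt 5, -v 1, (2 * v 0 + v 2) / Real.sqrt 5] := by
  rw [frameW, isoOfLinear_apply, frameW_lin_apply]

/-- `W (W v) = v`. [folklore] -/
theorem frameW_frameW (v : E3) : frameW (frameW v) = v := by
  rw [frameW, isoOfLinear_apply, isoOfLinear_apply, frameW_lin_involutive]

/-- The diagonal sign map `x ↦ (ε₀x₀, ε₁x₁, ε₂x₂)` as a linear map. [folklore] -/
def flipLin (ε : Fin 3 → ℤˣ) : E3 →ₗ[ℝ] E3 := rlin (Matrix.diagonal fun j => ((ε j : ℤ) : ℝ))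

/-- Coordinates of `flipLin`. [folklore] -/
theorem flipLin_apply (ε : Fin 3 → ℤˣ) (x : E3) (j : Fin 3) :
    flipLin ε x j = ((ε j : ℤ) : ℝ) * x j := by
  rw [flipLin, rlin_apply, Fin.sum_univ_three]
  fin_cases j <;> simp

/-- The signed coordinate isometries of `ℝ³` used below, as ONE constructor: `x ↦ (ε₀ x_{π 0},
ε₁ x_{π 1}, ε₂ x_{π 2})`. [folklore] -/
def signedIso (π : Equiv.Perm (Fin 3)) (ε : Fin 3 → ℤˣ) : E3 ≃ₗᵢ[ℝ] E3 :=
  (LinearIsometryEquiv.piLpCongrLeft 2 ℝ ℝ π.symm).trans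
    (isoOfLinear (flipLin ε) (flipLin ε)
      (by
        intro x; ext j
        have hu : ((ε j : ℤ) : ℝ) * ((ε j : ℤ) : ℝ) = 1 := by
          rcases Int.units_eq_one_or (ε j) with h | h <;> simp [h]
        rw [flipLin_apply, flipLin_apply, ← mul_assoc, hu, one_mul])
      (by
        intro x; ext j
        have hu : ((ε j : ℤ) : ℝ) * ((ε j : ℤ) : ℝ) = 1 := by
          rcases Int.units_eq_one_or (ε j) with h | h <;> simp [h]
        rw [flipLin_apply, flipLin_apply, ← mul_assoc, hu, one_mul])
      (by
        intro x
        apply norm_eq_of_sq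
        have hsq : ∀ j : Fin 3, (((ε j : ℤ) : ℝ) * x j) ^ 2 = x j ^ 2 := fun j => by
          rcases Int.units_eq_one_or (ε j) with h | h <;> simp [h]
        rw [flipLin_apply, flipLin_apply, flipLin_apply, hsq, hsq, hsq]))

/-- Coordinates of `signedIso`. [folklore] -/
theorem signedIso_apply (π : Equiv.Perm (Fin 3)) (ε : Fin 3 → ℤˣ) (x : E3) (j : Fin 3) :
    signedIso π ε x j = ((ε j : ℤ) : ℝ) * x (π j) := by
  simp only [signedIso, LinearIsometryEquiv.trans_apply, isoOfLinear_apply]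
  rw [flipLin_apply, MoebiusLimitExistsNegative.coordPerm_apply]
  simp

/-! ### The named elements and the two one-parameter groups -/

/-- `R_z(-90°) : (x₀,x₁,x₂) ↦ (x₁, -x₀, x₂)` as a signed coordinate isometry. [folklore] -/
def rzNeg90 : E3 ≃ₗᵢ[ℝ] E3 := signedIso (Equiv.swap 0 1) ![1, -1, 1]

/-- `R_x(90°) : (x₀,x₁,x₂) ↦ (x₀, -x₂, x₁)`. [folklore] -/
def rx90 : E3 ≃ₗᵢ[ℝ] E3 := signedIso (Equiv.swap 1 2) ![1, -1, 1]

/-- `R_c : (x₀,x₁,x₂) ↦ (-x₂, x₁, x₀)`. [folklore] -/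
def rc : E3 ≃ₗᵢ[ℝ] E3 := signedIso (Equiv.swap 0 2) ![-1, 1, 1]

/-- The coordinate reflection `(x₀,x₁,x₂) ↦ (-x₀, x₁, x₂)`. [folklore] -/
def flip0 : E3 ≃ₗᵢ[ℝ] E3 := signedIso 1 ![-1, 1, 1]

/-- `R_z(-90°)` in coordinates. [folklore] -/
theorem rzNeg90_apply (x : E3) : rzNeg90 x = WithLp.toLp 2 ![x 1, -x 0, x 2] := by
  ext j; fin_cases j <;> simp [rzNeg90, signedIso_apply, Equiv.swap_apply_of_ne_of_ne]

/-- `R_x(90°)` in coordinates. [folklore] -/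
theorem rx90_apply (x : E3) : rx90 x = WithLp.toLp 2 ![x 0, -x 2, x 1] := by
  ext j; fin_cases j <;> simp [rx90, signedIso_apply, Equiv.swap_apply_of_ne_of_ne]

/-- `R_c` in coordinates. [folklore] -/
theorem rc_apply (x : E3) : rc x = WithLp.toLp 2 ![-x 2, x 1, x 0] := by
  ext j; fin_cases j <;> simp [rc, signedIso_apply, Equiv.swap_apply_of_ne_of_ne]

/-- `R_c⁻¹` in coordinates. [folklore] -/
theorem rc_symm_apply (x : E3) : rc.symm x = WithLp.toLp 2 ![x 2, x 1, -x 0] := by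
  apply rc.injective
  rw [LinearIsometryEquiv.apply_symm_apply, rc_apply]
  ext j; fin_cases j <;> simp

/-- The coordinate reflection in coordinates. [folklore] -/
theorem flip0_apply (x : E3) : flip0 x = WithLp.toLp 2 ![-x 0, x 1, x 2] := by
  ext j; fin_cases j <;> simp [flip0, signedIso_apply]

/-- `R_z(60°)`: the transported sixfold map in the symmetric gauge. [folklore] -/
def rz60 : E3 ≃ₗᵢ[ℝ] E3 := rotZ (Real.pi / 3)

/-- `R_z(60°)` in coordinates. [folklore] -/
theorem rz60_apply (x : E3) :
    rz60 x = WithLp.toLp 2 ![x 0 / 2 - Real.sqrt 3 / 2 * x 1, Real.sqrt 3 / 2 * x 0 + x 1 / 2, x 2] := by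
  rw [rz60, rotZ_apply, Real.cos_pi_div_three, Real.sin_pi_div_three]
  ext j; fin_cases j <;> simp <;> ring

/-- `R_z(30°) = R_z(60°) ∘ R_z(60°) ∘ R_z(-90°)` in coordinates. [folklore] -/
theorem rz30_apply (x : E3) : rz60 (rz60 (rzNeg90 x)) =
    WithLp.toLp 2 ![Real.sqrt 3 / 2 * x 0 - x 1 / 2, x 0 / 2 + Real.sqrt 3 / 2 * x 1, x 2] := by
  have h3 : Real.sqrt 3 ^ 2 = 3 := Real.sq_sqrt (by norm_num)
  rw [rzNeg90_apply, rz60_apply, rz60_apply]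
  ext j; fin_cases j
  · simp; linear_combination (-(1:ℝ) / 4 * x 1) * h3
  · simp; linear_combination ((1:ℝ) / 4 * x 0) * h3
  · simp

/-- The one-parameter group `T φ := W R_z(φ) W`. [folklore] -/
def circleZ (φ : ℝ) : E3 ≃ₗᵢ[ℝ] E3 := (frameW.trans (rotZ φ)).trans frameW

/-- The conjugate one-parameter group `T' φ := W R_x(φ) W`. [folklore] -/
def circleX (φ : ℝ) : E3 ≃ₗᵢ[ℝ] E3 := (frameW.trans (rotX φ)).trans frameW

/-- `T φ x = W (R_z(φ) (W x))`. [folklore] -/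
theorem circleZ_apply (φ : ℝ) (x : E3) : circleZ φ x = frameW (rotZ φ (frameW x)) := rfl

/-- `T' φ x = W (R_x(φ) (W x))`. [folklore] -/
theorem circleX_apply (φ : ℝ) (x : E3) : circleX φ x = frameW (rotX φ (frameW x)) := rfl

/-- Group law of `R_z`. [folklore] -/
theorem rotZ_add (φ ψ : ℝ) (x : E3) : rotZ (φ + ψ) x = rotZ φ (rotZ ψ x) := by
  rw [rotZ_apply, rotZ_apply, rotZ_apply, Real.cos_add, Real.sin_add]
  ext j; fin_cases j <;> simp <;> ring

/-- Group law of `T`. [folklore] -/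
theorem circleZ_add (φ ψ : ℝ) (x : E3) : circleZ (φ + ψ) x = circleZ φ (circleZ ψ x) := by
  simp only [circleZ_apply, frameW_frameW, rotZ_add]

/-- `T (2π) = 1`. [folklore] -/
theorem circleZ_two_pi (x : E3) : circleZ (2 * Real.pi) x = x := by
  rw [circleZ_apply, rotZ_apply, Real.cos_two_pi, Real.sin_two_pi]
  have : (WithLp.toLp 2 ![1 * frameW x 0 - 0 * frameW x 1, 0 * frameW x 0 + 1 * frameW x 1,
      frameW x 2] : E3) = frameW x := by
    ext j; fin_cases j <;> simp
  rw [this, frameW_frameW]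

/-- Continuity of `φ ↦ T φ x`. [folklore] -/
theorem continuous_circleZ (x : E3) : Continuous fun φ => circleZ φ x := by
  have h : Continuous fun φ : ℝ => rotZ φ (frameW x) := by
    have : (fun φ : ℝ => rotZ φ (frameW x)) = fun φ => WithLp.toLp 2
        ![Real.cos φ * frameW x 0 - Real.sin φ * frameW x 1,
          Real.sin φ * frameW x 0 + Real.cos φ * frameW x 1, frameW x 2] := by
      funext φ; exact rotZ_apply φ _
    rw [this]
    refine (PiLp.continuous_toLp 2 (fun _ : Fin 3 => ℝ)).comp ?_
    refine continuous_pi fun j => ?_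
    fin_cases j <;> simp <;> fun_prop
  simp only [circleZ_apply]
  exact frameW.continuous.comp h

/-- **Registered sub-goal `isometries_circleZ_zero`** (the `--supports` anchor of this Defs-type
file): `T 0 = 1` for the one-parameter group `T φ = W R_z(φ) W`. [folklore] -/
theorem isometries_circleZ_zero :
    ∀ x : EuclideanSpace ℝ (Fin 3), circleZ 0 x = x := by
  intro x
  rw [circleZ_apply, rotZ_apply, Real.cos_zero, Real.sin_zero]
  have : (WithLp.toLp 2 ![1 * frameW x 0 - 0 * frameW x 1, 0 * frameW x 0 + 1 * frameW x 1,
      frameW x 2] : E3) = frameW x := by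
    ext j; fin_cases j <;> simp
  rw [this, frameW_frameW]

end Summit.CriticalPhenomena.Ising3DConformalLimit.Cruxes.RotationUpgradeFromTwoPoint.TwoCrystalsGenerateSo3

end
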